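import Summits.AtomisticToContinuum.Crystallization.Theorems.PalmUnimodularRigidityLayeredLawsSelectHcpCertificateDefs
import Summits.AtomisticToContinuum.Crystallization.Theorems.PalmUnimodularRigidityShellsToBarlowChartCubicGrowth

/-!
# The greedy step of a `1 %`-good shell
(stub `tube_starGreedyStep` of line `mtp-prestress-split-ergodic-frame`, crux `LayeredLawsSelectHcp`,
stmt-AtomisticToContinuum-9226)

The far field of the rigidity certificate needs a-priori LOWER bounds on the lengths `‖X u‖` of far
chart labels (`Cruxes/LayeredLawsSelectHcp/LeadC3FarField.md`, §1, §5, §6); they come from GREEDY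
DESCENT along bonds, whose single step is this file:

* `goodShell_iff_goodShellAt`: the crux's `(1/100)`-good-shell predicate `GoodShell S x`
  (`Negative.DiracLaws`) IS the scale-window predicate `GoodShellAt (9/10) 1 S x` of crux
  `ShellsToBarlowChart` (`Negative.Calibration`) — the two definitions agree verbatim, `Iff.rfl`;
* `goodShell_shellAt`: hence the landed SHELL FACTS `shellAt` of
  `PalmUnimodularRigidityShellsToBarlowChartCubicGrowth` apply: a scale `a ∈ [9/10, 1]`, all other
  points of `S` within `5a/4` at distance in `[0.99a, 1.01a]`, and (the `45°` covering angle of both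
  kissing patterns) for every direction `d` a neighbour `y'` with `⟪y' − x, d⟫ ≥ 0.697·a·‖d‖`;
* **`tube_starGreedyStep`** (registered): for every unit `e` a neighbour `y' ∈ S` with
  `0.891 ≤ dist y' y ≤ 1.01` and `⟪y' − y, e⟫ ≥ 0.627` (`0.697 · 9/10 = 0.6273`).

All `[folklore]`.
-/

noncomputable section

namespace Summit.AtomisticToContinuum.Crystallization.Theorems.PalmUnimodularRigidity.LayeredLawsSelectHcp

open Literature.MathematicalPhysics.StatisticalMechanics Literature.Geometry.DiscreteGeometry
open Summit.AtomisticToContinuum.Crystallization.Theorems.LayeredLawsSelectHcp.Negative.DiracLaws (GoodShell)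
open Summit.AtomisticToContinuum.Crystallization.Theorems.ShellsToBarlowChartNegative (GoodShellAt)
open Summit.AtomisticToContinuum.Crystallization.Theorems.PalmUnimodularRigidityShellsToBarlowChart (shellAt)

/-- **The bridge** between the two good-shell predicates: the crux's `GoodShell S x` is LITERALLY the
scale-window predicate `GoodShellAt (9/10) 1 S x` of crux `ShellsToBarlowChart` (same matching error
`a / 100`, same radius `5a/4`, same patterns): `Iff.rfl`. [folklore] -/
theorem goodShell_iff_goodShellAt (S : Set (EuclideanSpace ℝ (Fin 3))) (x : EuclideanSpace ℝ (Fin 3)) :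
    GoodShell S x ↔ GoodShellAt (9 / 10) 1 S x :=
  Iff.rfl

/-- **Shell facts at a `(1/100)`-good point** (the landed `shellAt` through the bridge): a scale
`a ∈ [9/10, 1]`; every other point of `S` within `5a/4` of `x` is at distance in `[0.99a, 1.01a]`; and for
every vector `d` some such point `y` has `⟪y − x, d⟫ ≥ 0.697·a·‖d‖`. [folklore] -/
theorem goodShell_shellAt {S : Set (EuclideanSpace ℝ (Fin 3))} {x : EuclideanSpace ℝ (Fin 3)}
    (h : GoodShell S x) :
    ∃ a : ℝ, 9 / 10 ≤ a ∧ a ≤ 1 ∧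
      (∀ y ∈ S, y ≠ x → dist y x ≤ 5 / 4 * a →
          99 / 100 * a ≤ dist y x ∧ dist y x ≤ 101 / 100 * a) ∧
      (∀ d : EuclideanSpace ℝ (Fin 3), ∃ y ∈ S, y ≠ x ∧ dist y x ≤ 5 / 4 * a ∧
          697 / 1000 * a * ‖d‖ ≤ inner ℝ (y - x) d) :=
  shellAt ((goodShell_iff_goodShellAt S x).1 h)

/-- **Every point of `S` within `9/8` of a `(1/100)`-good point `x` is a shell point**: at distance in
`[0.891, 1.01]` (`9/8 ≤ 5a/4`, `0.99a ≥ 0.891`, `1.01a ≤ 1.01`). [folklore] -/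
theorem goodShell_dist_mem {S : Set (EuclideanSpace ℝ (Fin 3))} {x y : EuclideanSpace ℝ (Fin 3)}
    (h : GoodShell S x) (hy : y ∈ S) (hne : y ≠ x) (hd : dist y x ≤ 9 / 8) :
    891 / 1000 ≤ dist y x ∧ dist y x ≤ 101 / 100 := by
  obtain ⟨a, ha9, ha1, hshell, -⟩ := goodShell_shellAt h
  obtain ⟨hlo, hhi⟩ := hshell y hy hne (by linarith)
  constructor <;> linarith

/-- **Registered stub `tube_starGreedyStep` (G1): the greedy step.**  A `(1/100)`-good shell at `y` has,
for every unit direction `e`, a neighbour `y' ∈ S` at distance in `[0.891, 1.01]` with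
`⟪y' − y, e⟫ ≥ 0.627`: both kissing patterns cover the sphere with `45°` caps, so some pattern point makes
inner product `≥ a(√2/2 − 1/100) ≥ 0.697a ≥ 0.6273` with `e` (`a ≥ 9/10`). [folklore] -/
theorem tube_starGreedyStep : ∀ (S : Set (EuclideanSpace ℝ (Fin 3))) (y : EuclideanSpace ℝ (Fin 3)), GoodShell S y → ∀ e : EuclideanSpace ℝ (Fin 3), ‖e‖ = 1 → ∃ y' ∈ S, 891 / 1000 ≤ dist y' y ∧ dist y' y ≤ 101 / 100 ∧ 627 / 1000 ≤ inner ℝ (y' - y) e := by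
  intro S y hy e he
  obtain ⟨a, ha9, ha1, hshell, hdir⟩ := goodShell_shellAt hy
  obtain ⟨y', hy'S, hne, hd, hinner⟩ := hdir e
  obtain ⟨hlo, hhi⟩ := hshell y' hy'S hne hd
  refine ⟨y', hy'S, by linarith, by linarith, ?_⟩
  rw [he, mul_one] at hinner
  linarith

end Summit.AtomisticToContinuum.Crystallization.Theorems.PalmUnimodularRigidity.LayeredLawsSelectHcp

end
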